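import Literature.NumberTheory.Automorphic.QuadraticLocalUnramifiedUnitNorm   -- ★ `exists_eq_toLocalRing_of_conjLocal_eq` (fixed points of `σ ⊗ 1` are `ι_v(F_v)`), ★ `QuadraticLocalBaseChange`
import Literature.NumberTheory.QuadraticForms.GlobalSquareTheorem
import HarnessLib

/-!
# The unit group of `E ⊗_F F_v = ∏_{w ∣ v} E_w` is open and embedded, and the unit-norm test «`x = z · (σ ⊗ 1) z`, `z` a unit»
# is LOCALLY CONSTANT on the `(σ ⊗ 1)`-fixed units (O'Meara 63:1b: local squares form a neighbourhood of `1`)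

Topic `NumberTheory/Automorphic`; namespace `Literature.NumberTheory.Automorphic.UnitaryGroup` (home of ★ `LocalRing E v = ∏_{w ∣ v} E_w`, ★ `conjLocal`,
★ `toLocalRing`, ★ `quadraticLocalEquiv`).  THEOREMS ONLY (no definition, no named fact, no instance, no notation, no `sorry`; net debt 0).  Cell
`pub/hodgecm-mathlib`, F0∕P3a, topic T6 (#88 side, the transfer-factor half of node D-G4 of `SIZING-S1prime` §2∕§5: local constancy of the sign `κ_v` of
Rogawski's explicit factor `Δ‴_v` near a `(G,H)`-regular matching pair — consumed by `Rogawski1990/FinExplicitTransferFactorLocallyConstant`).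

SETTING ([CasselsFrohlichANT1967] Ch. II §§10–11).  `E ∕ F` number fields, `v` a finite place of `F`, `E ⊗_F F_v = ∏_{w ∣ v} E_w = LocalRing E v` (product
topology of the valued fields `E_w`); in §§2–4 `E ∕ F` is quadratic, presented by `σ ∈ Aut(E∕F)` and `δ ∈ E` with `σ δ = −δ ≠ 0`, `ι_v = toLocalRing E v : F_v →+* ∏ E_w`,
and ★ `quadraticLocalEquiv : F_v × F_v ≃L[F_v] ∏ E_w`, `(a, b) ↦ ι_v a + ι_v b · δ`.  The UNIT-NORM TEST of `x ∈ ∏ E_w` is the proposition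
`∃ z, IsUnit z ∧ x = z · (σ ⊗ 1) z` — the `κ_v`-test of ★ `Rogawski1990.finKappaAt` (non-split `v`), equal to the Hilbert symbol `(x, d)_v` on `ι_v(F_v^×)` (★
`exists_isUnit_toLocalRing_eq_mul_conjLocal_iff`).

* §1 **`isOpen_setOf_isUnit_localRing`** — the units of `∏ E_w` form an OPEN set (`x` is a unit iff every `x_w ≠ 0`); **`isEmbedding_units_val_localRing`** — the
  unit group `(∏ E_w)^×` carries the SUBSPACE topology (inversion is continuous on the units of each `E_w`, Mathlib `continuousAt_inv₀`, `Units.embedding_val_mk`);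
  **`continuousAt_of_eq_apply_unit`** — a function that agrees on units with `g ∘ (x ↦ x as a unit)` for a continuous `g : (∏ E_w)^× → X` is continuous at
  every unit (the shape of ★ `Rogawski1990.finHeckeValue`: `μ_v(x) = μ.semilocalComponent v x` at units, `0` else).
* §2 **`eq_toLocalRing_fst_of_conjLocal_eq`** — a `(σ ⊗ 1)`-fixed `x ∈ ∏ E_w` is `ι_v a` with `a = (quadraticLocalEquiv⁻¹ x).1` depending CONTINUOUSLY
  on `x` (the existence form is ★ `exists_eq_toLocalRing_of_conjLocal_eq`, re-used, not restated); `quadraticLocalEquiv_symm_toLocalRing`.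
* §3 **`exists_isUnit_mul_toLocalRing_mul_self`** — the test is stable under multiplication by `ι_v(s²)`, `s ∈ F_v^×` (`z ↦ z · ι_v s`, `(σ ⊗ 1) ι_v s = ι_v s`).
* §4 **`eventually_normTest_iff_of_conjLocal_eq`** (HEAD) — for a `(σ ⊗ 1)`-fixed UNIT `x₀`: for all `x` near `x₀` with `(σ ⊗ 1) x = x`, the test holds at `x`
  iff it holds at `x₀`.  Proof: `x₀ = ι_v a₀`, `a₀ ≠ 0`; `x = ι_v a` with `a = (quadraticLocalEquiv⁻¹ x).1` depending continuously on `x`; for `v(a − a₀) < v(4a₀)`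
  both `a∕a₀` and `a₀∕a` are squares of `F_v` [Omeara1963 63:1b] (★ `QuadraticForms.isSquare_div_of_valued_sub_lt`), and §3.  Also the `nhdsWithin` form
  `eventually_nhdsWithin_normTest_iff`.  (At `x₀ = 0` the test is NOT locally constant — every neighbourhood of `0` contains unit norms — so the unit
  hypothesis is sharp.)

HONEST LABEL: HC_CM is proved only modulo the printed citations until rung 0 closes; this file is local algebra∕topology of quadratic extensions and proves
none of them.

## References
* [Omeara1963] O. T. O'Meara, *Introduction to Quadratic Forms* (1963), §63A Cor. 63:1b («`F_𝔭²` is an open subset of `F_𝔭`»), §63B (local norm groups).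
* [CasselsFrohlichANT1967] J. W. S. Cassels, A. Fröhlich (eds.), *Algebraic Number Theory* (1967), Ch. II §§10–11 (`L ⊗_K K_v ≅ ∏_{w∣v} L_w`).
* [Rogawski1990] J. D. Rogawski, *Automorphic Representations of Unitary Groups in Three Variables* (1990), §4.3 p. 43, §14.6 p. 242 (`κ(γ, ψ_v(i(γ))) = ±1`),
  Prop. 8.1.3 proof p. 116 (the transfer factor near a singular pair).
-/

set_option autoImplicit false

noncomputable section

open NumberField IsDedekindDomain Filter Topology

namespace Literature.NumberTheory.Automorphic.UnitaryGroup

variable {F : Type} (E : Type) [Field F] [NumberField F] [Field E] [NumberField E] [Algebra F E]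
variable (v : HeightOneSpectrum (𝓞 F))

/-! ## §1 Units of `∏_{w ∣ v} E_w`: an open set, an embedded unit group -/

section Units

omit [NumberField F] in
/-- `x ∈ ∏_{w ∣ v} E_w` is a unit iff every component is non-zero. [cite: CasselsFrohlichANT1967, Ch. II §10–§11] -/
theorem isUnit_localRing_iff (x : LocalRing E v) : IsUnit x ↔ ∀ w : PlacesOver E v, x w ≠ 0 := by
  rw [Pi.isUnit_iff]
  exact forall_congr' fun w => isUnit_iff_ne_zero

/-- **The units of `E ⊗_F F_v = ∏_{w ∣ v} E_w` form an open set.** [cite: CasselsFrohlichANT1967, Ch. II §10–§11] -/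
theorem isOpen_setOf_isUnit_localRing : IsOpen {x : LocalRing E v | IsUnit x} := by
  have hset : {x : LocalRing E v | IsUnit x} = ⋂ w : PlacesOver E v, (fun x : LocalRing E v => x w) ⁻¹' {0}ᶜ := by
    ext x
    simp only [Set.mem_setOf_eq, isUnit_localRing_iff, Set.mem_iInter, Set.mem_preimage, Set.mem_compl_iff,
      Set.mem_singleton_iff]
  rw [hset]
  exact isOpen_iInter_of_finite fun w => isOpen_compl_singleton.preimage (continuous_apply w)

omit [NumberField F] in
/-- Inversion is continuous on the units of `∏_{w ∣ v} E_w` (componentwise `continuousAt_inv₀`). [cite: CasselsFrohlichANT1967, Ch. II §10–§11] -/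
theorem continuousOn_inv_setOf_isUnit_localRing : ContinuousOn (fun x : LocalRing E v => x⁻¹) {x : LocalRing E v | IsUnit x} := by
  intro x hx
  refine ContinuousAt.continuousWithinAt ?_
  rw [Set.mem_setOf_eq, isUnit_localRing_iff] at hx
  refine continuousAt_pi.2 fun w => ?_
  have h : (fun y : LocalRing E v => y⁻¹ w) = fun y => (y w)⁻¹ := rfl
  rw [h]
  exact (continuousAt_inv₀ (hx w)).comp (continuous_apply w).continuousAt

omit [NumberField F] in
/-- **The unit group `(∏_{w ∣ v} E_w)^×` carries the subspace topology** (`Units.val` is a topological embedding).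
[cite: CasselsFrohlichANT1967, Ch. II §10–§11] -/
theorem isEmbedding_units_val_localRing : IsEmbedding (Units.val : (LocalRing E v)ˣ → LocalRing E v) :=
  Units.embedding_val_mk (continuousOn_inv_setOf_isUnit_localRing E v)

/-- **Continuity at units of a function read through the unit group**: if `f x = g (x as a unit)` at every unit `x` for a continuous
`g : (∏ E_w)^× → X`, then `f` is continuous at every unit (e.g. `μ_v = μ.semilocalComponent v` at units, `0` else).
[cite: CasselsFrohlichANT1967, Ch. II §10–§11] -/
theorem continuousAt_of_eq_apply_unit {X : Type*} [TopologicalSpace X] {g : (LocalRing E v)ˣ → X} (hg : Continuous g)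
    {f : LocalRing E v → X} (hf : ∀ (y : LocalRing E v) (hy : IsUnit y), f y = g hy.unit) {x : LocalRing E v} (hx : IsUnit x) :
    ContinuousAt f x := by
  classical
  have hU : {y : LocalRing E v | IsUnit y} ∈ 𝓝 x := (isOpen_setOf_isUnit_localRing E v).mem_nhds hx
  set lift : LocalRing E v → (LocalRing E v)ˣ := fun y => if h : IsUnit y then h.unit else 1 with hlift_def
  have hlift : ContinuousOn lift {y : LocalRing E v | IsUnit y} := by
    rw [(isEmbedding_units_val_localRing E v).continuousOn_iff]
    refine continuousOn_id.congr fun y hy => ?_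
    rw [Set.mem_setOf_eq] at hy
    simp only [Function.comp_apply, hlift_def, dif_pos hy, IsUnit.unit_spec, id]
  have hf' : ContinuousOn f {y : LocalRing E v | IsUnit y} := by
    refine (hg.comp_continuousOn hlift).congr fun y hy => ?_
    rw [Set.mem_setOf_eq] at hy
    simp only [Function.comp_apply, hlift_def, dif_pos hy, hf y hy]
  exact hf'.continuousAt hU

end Units

/-! ## §2 `(σ ⊗ 1)`-fixed elements are `ι_v a`, with `a` the first coordinate -/

section Fixed

variable (σ : E ≃ₐ[F] E) {δ : E} (hσδ : σ δ = -δ) (hδ : δ ≠ 0)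

include hσδ hδ in
/-- The coordinates of `ι_v a` are `(a, 0)`: `quadraticLocalEquiv⁻¹ (ι_v a) = (a, 0)`. [cite: CasselsFrohlichANT1967, Ch. II §10–§11] -/
theorem quadraticLocalEquiv_symm_toLocalRing [Algebra.IsQuadraticExtension F E] (a : v.adicCompletion F) :
    (quadraticLocalEquiv E v σ hσδ hδ).symm (toLocalRing E v a) = (a, 0) := by
  have h : quadraticLocalEquiv E v σ hσδ hδ (a, 0) = toLocalRing E v a := by
    rw [quadraticLocalEquiv_apply, map_zero, zero_mul, add_zero]
  rw [← h, ContinuousLinearEquiv.symm_apply_apply]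

include hσδ hδ in
/-- **A `(σ ⊗ 1)`-fixed element of `E ⊗_F F_v` is `ι_v` of its first coordinate**: `x = ι_v (quadraticLocalEquiv⁻¹ x).1` (★
`exists_eq_toLocalRing_of_conjLocal_eq`: the fixed points of `σ ⊗ 1` are `ι_v(F_v)`; the coordinate form is what makes the dependence on `x`
CONTINUOUS). [cite: CasselsFrohlichANT1967, Ch. II §10–§11] -/
theorem eq_toLocalRing_fst_of_conjLocal_eq [Algebra.IsQuadraticExtension F E] {x : LocalRing E v} (hx : conjLocal E σ v x = x) :
    x = toLocalRing E v ((quadraticLocalEquiv E v σ hσδ hδ).symm x).1 := by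
  obtain ⟨a, rfl⟩ := exists_eq_toLocalRing_of_conjLocal_eq E σ hσδ hδ v hx
  rw [quadraticLocalEquiv_symm_toLocalRing]

end Fixed

/-! ## §3 The unit-norm test is stable under squares of `F_v^×` -/

section Squares

variable (σ : E ≃ₐ[F] E)

/-- **`x ↦ x · ι_v(s²)` preserves the unit-norm test** (`s ∈ F_v^×`): `z (σ⊗1) z · ι(s)² = (z ι s)·(σ⊗1)(z ι s)`.
[cite: Omeara1963, §63B] -/
theorem exists_isUnit_mul_toLocalRing_mul_self {x : LocalRing E v} (hx : ∃ z : LocalRing E v, IsUnit z ∧ x = z * conjLocal E σ v z)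
    {s : v.adicCompletion F} (hs : s ≠ 0) :
    ∃ z : LocalRing E v, IsUnit z ∧ x * toLocalRing E v (s * s) = z * conjLocal E σ v z := by
  obtain ⟨z, hz, hxz⟩ := hx
  refine ⟨z * toLocalRing E v s, hz.mul ((isUnit_iff_ne_zero.2 hs).map (toLocalRing E v)), ?_⟩
  rw [hxz, map_mul (conjLocal E σ v), conjLocal_toLocalRing, map_mul (toLocalRing E v)]
  ring

end Squares

/-! ## §4 The unit-norm test is locally constant on the `(σ ⊗ 1)`-fixed units -/

section LocallyConstant

variable (σ : E ≃ₐ[F] E) {δ : E} (hσδ : σ δ = -δ) (hδ : δ ≠ 0)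

omit [NumberField E] [Algebra F E] in
/-- `v(4) ≤ 1` in `F_v` (`4` is an integer). [folklore] -/
private theorem valued_four_le_one : Valued.v (4 : v.adicCompletion F) ≤ 1 := by
  have h : ((4 : v.adicCompletionIntegers F) : v.adicCompletion F) = 4 := by norm_cast
  rw [← h]
  exact (4 : v.adicCompletionIntegers F).2

omit [NumberField E] [Algebra F E] in
/-- If `v(a − a₀) < v(4 a₀)` then `a ≠ 0`. [cite: Omeara1963, §63A Cor. 63:1b] -/
private theorem ne_zero_of_valued_sub_lt {a a₀ : v.adicCompletion F} (h : Valued.v (a - a₀) < Valued.v (4 * a₀)) : a ≠ 0 := by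
  rintro rfl
  rw [zero_sub, Valuation.map_neg, Valuation.map_mul] at h
  have h1 : Valued.v (4 : v.adicCompletion F) * Valued.v a₀ ≤ 1 * Valued.v a₀ :=
    mul_le_mul_left (valued_four_le_one v) _
  rw [one_mul] at h1
  exact lt_irrefl _ (lt_of_lt_of_le h h1)

include hσδ hδ in
/-- **THE UNIT-NORM TEST IS LOCALLY CONSTANT ON THE `(σ ⊗ 1)`-FIXED UNITS OF `E ⊗_F F_v`.**  For a `(σ ⊗ 1)`-fixed unit `x₀ ∈ ∏_{w ∣ v} E_w`:
for every `x` close enough to `x₀` with `(σ ⊗ 1) x = x`, «`x = z·(σ⊗1)z` for a unit `z`» holds iff it holds for `x₀`.  (`x₀ = ι_v a₀`, `x = ι_v a`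
with `a` near `a₀ ≠ 0`, and `a∕a₀`, `a₀∕a ∈ F_v^{×2}` — O'Meara 63:1b «`F_𝔭²` is an open subset of `F_𝔭`» — so `x`, `x₀` differ by the unit norm
`ι_v(s²) = ι_v s · (σ⊗1) ι_v s`.)  This is the local constancy of the sign `κ_v` of Rogawski's explicit transfer factor in its relative-position
variable. [cite: Omeara1963, §63A Cor. 63:1b with §63B] [cite: Rogawski1990, §14.6 p. 242; Prop. 8.1.3 proof p. 116] -/
theorem eventually_normTest_iff_of_conjLocal_eq [Algebra.IsQuadraticExtension F E] {x₀ : LocalRing E v}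
    (hfix : conjLocal E σ v x₀ = x₀) (hu : IsUnit x₀) :
    ∀ᶠ x in 𝓝 x₀, conjLocal E σ v x = x →
      ((∃ z : LocalRing E v, IsUnit z ∧ x = z * conjLocal E σ v z) ↔
        (∃ z : LocalRing E v, IsUnit z ∧ x₀ = z * conjLocal E σ v z)) := by
  -- coordinates: `x₀ = ι a₀`, `a₀ ≠ 0`
  set a₀ : v.adicCompletion F := ((quadraticLocalEquiv E v σ hσδ hδ).symm x₀).1 with ha₀
  have hx₀ : x₀ = toLocalRing E v a₀ := eq_toLocalRing_fst_of_conjLocal_eq E v σ hσδ hδ hfix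
  have ha₀ne : a₀ ≠ 0 := by
    intro h0
    apply hu.ne_zero
    rw [hx₀, h0, map_zero]
  have h4a₀ : Valued.v (4 * a₀) ≠ 0 := by
    haveI : CharZero (v.adicCompletion F) := charZero_of_injective_algebraMap (algebraMap F _).injective
    exact (Valuation.ne_zero_iff _).2 (mul_ne_zero (by norm_num) ha₀ne)
  -- the neighbourhood: coordinates in the O'Meara ball around `a₀`
  have hcont : Continuous fun x : LocalRing E v => ((quadraticLocalEquiv E v σ hσδ hδ).symm x).1 :=
    continuous_fst.comp (quadraticLocalEquiv E v σ hσδ hδ).symm.continuous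
  have hball : {a : v.adicCompletion F | Valued.v (a - a₀) < Valued.v (4 * a₀)} ∈ 𝓝 a₀ := ball_mem_nhds v a₀ (4 * a₀) h4a₀
  have hmem : (fun x : LocalRing E v => ((quadraticLocalEquiv E v σ hσδ hδ).symm x).1) ⁻¹'
      {a : v.adicCompletion F | Valued.v (a - a₀) < Valued.v (4 * a₀)} ∈ 𝓝 x₀ := by
    refine hcont.continuousAt.preimage_mem_nhds ?_
    rw [← ha₀]
    exact hball
  filter_upwards [hmem] with x hx hxfix
  rw [Set.mem_preimage, Set.mem_setOf_eq] at hx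
  set a : v.adicCompletion F := ((quadraticLocalEquiv E v σ hσδ hδ).symm x).1 with ha
  have hxa : x = toLocalRing E v a := eq_toLocalRing_fst_of_conjLocal_eq E v σ hσδ hδ hxfix
  have hane : a ≠ 0 := ne_zero_of_valued_sub_lt v hx
  obtain ⟨⟨s, hs⟩, ⟨s', hs'⟩⟩ := QuadraticForms.isSquare_div_of_valued_sub_lt F v ha₀ne hx
  -- `a = a₀ · s²`, `a₀ = a · s′²`
  have hsne : s ≠ 0 := by
    intro h0
    rw [h0, mul_zero, div_eq_zero_iff] at hs
    exact hs.elim hane ha₀ne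
  have hs'ne : s' ≠ 0 := by
    intro h0
    rw [h0, mul_zero, div_eq_zero_iff] at hs'
    exact hs'.elim ha₀ne hane
  have ha_eq : a = a₀ * (s * s) := by rw [← hs]; field_simp
  have ha₀_eq : a₀ = a * (s' * s') := by rw [← hs']; field_simp
  constructor
  · intro hxN
    have h := exists_isUnit_mul_toLocalRing_mul_self E v σ hxN hs'ne
    rwa [hxa, ← map_mul, ← ha₀_eq, ← hx₀] at h
  · intro hx₀N
    have h := exists_isUnit_mul_toLocalRing_mul_self E v σ hx₀N hsne
    rwa [hx₀, ← map_mul, ← ha_eq, ← hxa] at h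

include hσδ hδ in
/-- The same, within the `(σ ⊗ 1)`-fixed subspace: the unit-norm test is eventually (in `𝓝[fixed] x₀`) equivalent to its value at the
`(σ ⊗ 1)`-fixed unit `x₀`. [cite: Omeara1963, §63A Cor. 63:1b with §63B] -/
theorem eventually_nhdsWithin_normTest_iff [Algebra.IsQuadraticExtension F E] {x₀ : LocalRing E v}
    (hfix : conjLocal E σ v x₀ = x₀) (hu : IsUnit x₀) :
    ∀ᶠ x in 𝓝[{x : LocalRing E v | conjLocal E σ v x = x}] x₀,
      ((∃ z : LocalRing E v, IsUnit z ∧ x = z * conjLocal E σ v z) ↔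
        (∃ z : LocalRing E v, IsUnit z ∧ x₀ = z * conjLocal E σ v z)) := by
  rw [eventually_nhdsWithin_iff]
  exact eventually_normTest_iff_of_conjLocal_eq E v σ hσδ hδ hfix hu

end LocallyConstant

end Literature.NumberTheory.Automorphic.UnitaryGroup

end
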